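import Literature.Analysis.FluidPDE.TypeIRateScaledEnergyBound
import HarnessLib

/-!
# The `L∞` Type-I rate bounds the scaled energies — constant UNIFORM in the vertex and the solution
# (Seregin 2014, Prop. 3.11 (i), case `G₂`; Seregin–Šverák 2009, Lemma 3.5)

Analysis/FluidPDE proofs-layer file (theorems only; no definitions, no named facts), companion of
`TypeIRateScaledEnergyBound.lean` / `ScaledEnergyBoundOfCubicAbsorption.lean`.

G. Seregin, V. Šverák, *On Type I singularities of the local axi-symmetric solutions of the
Navier–Stokes equations*, Comm. PDE 34 (2009) 171–201 = arXiv:0804.1803, Lemma 3.5, prints its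
bound `A + E + C + D ≤ C₁` with "`C₁` depending only on `C`, `‖v‖_{L³(Q)}`, `‖q‖_{L^{3/2}(Q)}`"
(arXiv p. 9). The tree theorems `scaledEnergies_bounded_of_cubicAbsorption` and
`scaledEnergies_bounded_of_typeIRate` render the bound at one vertex `z` with `∃ K` AFTER the
solution and the vertex. This file re-runs the same proof with the quantifiers in the printed
order: the constant is chosen from the Type-I constant `c` and from bounds `C₀ ≥ C(r₀; z)`,
`D₀ ≥ D(r₀; z)` on the background quantities at the base radius ONLY, before the solution, the
vertex and the base radius are given. Nothing but the bookkeeping changes: the constants of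
(as12) (`Seregin2020.localEnergyBound_top`) and (as13) (`seregin_sverak_pressure_decay_holds`) are
universal, the absorption constant `f₁(ε)` of (as11) depends on `c` and `ε` only
(`cknC_le_of_typeIRate`), and the top scales of the iteration are controlled by
`A(r₀/2) + E(r₀/2) ≤ K₀ (C(r₀)^{2/3} + C(r₀) + D(r₀)) ≤ K₀ (C₀^{2/3} + C₀ + D₀)` and `D(r₀) ≤ D₀`.

* `cubicAbsorption_of_typeIRate_unif` — (as11) with an absorption function `ε ↦ f₁(ε)` depending
  on the Type-I constant only;
* `scaledEnergies_bounded_of_cubicAbsorption_unif` — the iteration with a uniform constant, given a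
  uniform absorption function;
* `scaledEnergies_bounded_of_typeIRate_unif` — Prop. 3.11 (i), case `G₂`, uniform form:
  `∀ c C₀ D₀, ∃ K, ∀ (suitable weak solution, weak gradient, vertex z, base radius r₀)`,
  `C(r₀; z) ≤ C₀ → D(r₀; z) ≤ D₀ → (√(t_z − t) ‖u‖ ≤ c a.e. on Q_{r₀}(z)) →
  ∀ r ∈ (0, r₀/2), A + E + C + D ≤ K`.

Use: bounds uniform in the centre for whole-space solutions whose background quantities are
controlled globally (e.g. a Leray–Hopf solution with the Type-I rate near a blow-up time: the
scale-invariant local energy `sup_{x, r} r⁻¹ ∫_{B(x,r)} |u(t)|²` is bounded).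

## References

* G. Seregin, V. Šverák, Comm. PDE 34 (2009) 171–201 = arXiv:0804.1803, Lemma 3.5 (statement of
  the dependence of `C₁`) and its proof, (as11)–(as13) (pp. 9–10). [`SereginSverak2009`]
* G. Seregin, *Lecture Notes on Regularity Theory for the Navier–Stokes Equations* (2014), Ch. 6
  §6.3, Prop. 3.11 (i). [`Seregin2014`]
-/

noncomputable section

open MeasureTheory Set Function Filter Topology TopologicalSpace Metric
open scoped NNReal ENNReal

namespace Literature.Analysis.FluidPDE

/-- **(as11) with a uniform absorption function.** For every Type-I constant `c` there is a
function `f₁ : ℝ≥0 → ℝ≥0` such that for every field `u` a.e. strongly measurable on a backward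
cylinder `Q_{r₀}(z)` and obeying `√(t_z − t) ‖u(t, x)‖ ≤ c` a.e. there, every candidate gradient
`G` and every `ε > 0`: `C(r; z) ≤ ε (E(r; z) + A(r; z)) + f₁(ε)` for all `0 < r ≤ r₀`
(`cknC_le_of_typeIRate` with `K = max(c, 1)`, window parameter `η = min(1, ε/(2K))`,
`f₁(ε) = K³ η⁻³ |B₁|`). [cite: SereginSverak2009, proof of Lemma 3.5, (as11) (arXiv p. 10)]
[cite: Seregin2014, Ch. 6 §6.3 Prop. 3.11 (i)] -/
theorem cubicAbsorption_of_typeIRate_unif (c : ℝ) :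
    ∃ f₁ : ℝ≥0 → ℝ≥0, ∀ {u : ℝ → EuclideanSpace ℝ (Fin 3) → EuclideanSpace ℝ (Fin 3)}
      {z : ℝ × EuclideanSpace ℝ (Fin 3)} {r₀ : ℝ},
      AEStronglyMeasurable (uncurry u) (volume.restrict (parabolicCylinder r₀ z)) →
      (∀ᵐ w ∂(volume.restrict (parabolicCylinder r₀ z)), Real.sqrt (z.1 - w.1) * ‖u w.1 w.2‖ ≤ c) →
      ∀ (G : ℝ → EuclideanSpace ℝ (Fin 3) → EuclideanSpace ℝ (Fin 3) →L[ℝ] EuclideanSpace ℝ (Fin 3))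
        (ε : ℝ≥0), 0 < ε →
      ∀ r ∈ Ioc (0 : ℝ) r₀, cknC r z u ≤ ε * (cknE r z G + cknAEss r z u) + f₁ ε := by
  -- the Type I constant, made `≥ 1`
  set K : ℝ := max c 1 with hK
  have hK0 : 0 < K := lt_of_lt_of_le one_pos (le_max_right _ _)
  -- the window parameter `η(ε)` and the constant `f₁(ε) = |B₁| K³ / η³`
  set η : ℝ≥0 → ℝ := fun ε => min 1 ((ε : ℝ) / (2 * K)) with hη
  set V : ℝ≥0 := (volume (ball (0 : EuclideanSpace ℝ (Fin 3)) 1)).toNNReal with hVdef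
  have hV : volume (ball (0 : EuclideanSpace ℝ (Fin 3)) 1) ≠ ⊤ := measure_ball_lt_top.ne
  have hVcoe : (V : ℝ≥0∞) = volume (ball (0 : EuclideanSpace ℝ (Fin 3)) 1) :=
    ENNReal.coe_toNNReal hV
  refine ⟨fun ε => Real.toNNReal (K ^ 3 / η ε ^ 3) * V, ?_⟩
  intro u z r₀ hu hc G ε hε r hr
  have hcK : ∀ᵐ w ∂(volume.restrict (parabolicCylinder r₀ z)),
      Real.sqrt (z.1 - w.1) * ‖u w.1 w.2‖ ≤ K :=
    hc.mono fun w hw => hw.trans (le_max_left _ _)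
  have hε0 : (0 : ℝ) < ε := by exact_mod_cast hε
  have hη0 : 0 < η ε := lt_min one_pos (by positivity)
  have hη1 : η ε ≤ 1 := min_le_left _ _
  have hKη : 2 * K * η ε ≤ ε := by
    calc 2 * K * η ε ≤ 2 * K * ((ε : ℝ) / (2 * K)) := by gcongr; exact min_le_right _ _
      _ = ε := by field_simp
  have hFcoe : ENNReal.ofReal (K ^ 3 / η ε ^ 3) * volume (ball (0 : EuclideanSpace ℝ (Fin 3)) 1) =
      ((Real.toNNReal (K ^ 3 / η ε ^ 3) * V : ℝ≥0) : ℝ≥0∞) := by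
    rw [ENNReal.coe_mul, hVcoe]
    rfl
  have ha : ENNReal.ofReal (2 * K * η ε) ≤ ε := by
    rw [← ENNReal.ofReal_coe_nnreal]; exact ENNReal.ofReal_le_ofReal hKη
  -- the rate and measurability on `Q_r(z) ⊆ Q_{r₀}(z)`
  have hsub : parabolicCylinder r z ⊆ parabolicCylinder r₀ z := by
    have h2 : r ^ 2 ≤ r₀ ^ 2 := pow_le_pow_left₀ hr.1.le hr.2 2
    exact prod_mono (Ioo_subset_Ioo (by linarith) le_rfl) (ball_subset_ball hr.2)
  have hur : AEStronglyMeasurable (uncurry u) (volume.restrict (parabolicCylinder r z)) :=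
    hu.mono_measure (Measure.restrict_mono hsub le_rfl)
  have hIr : ∀ᵐ w ∂(volume.restrict (parabolicCylinder r z)),
      Real.sqrt (z.1 - w.1) * ‖u w.1 w.2‖ ≤ K :=
    ae_restrict_of_ae_restrict_of_subset hsub hcK
  calc cknC r z u
      ≤ ENNReal.ofReal (2 * K * η ε) * cknAEss r z u +
          ENNReal.ofReal (K ^ 3 / η ε ^ 3) * volume (ball (0 : EuclideanSpace ℝ (Fin 3)) 1) :=
        cknC_le_of_typeIRate hr.1 hK0.le hur hIr hη0 hη1
    _ = ENNReal.ofReal (2 * K * η ε) * cknAEss r z u +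
          ((Real.toNNReal (K ^ 3 / η ε ^ 3) * V : ℝ≥0) : ℝ≥0∞) := by rw [hFcoe]
    _ ≤ ε * (cknE r z G + cknAEss r z u) + ((Real.toNNReal (K ^ 3 / η ε ^ 3) * V : ℝ≥0) : ℝ≥0∞) :=
        add_le_add (mul_le_mul' ha le_add_self) le_rfl

/-- **Scaled energies bounded from cubic absorption, constant uniform in the solution and the
vertex** (Seregin–Šverák 2009, proof of Lemma 3.5, with the printed dependence of the constant).
Given a uniform absorption function `f₁` and bounds `C₀, D₀`, there is `K` such that for every
suitable weak solution `(u, p)` of the unforced unit-viscosity equations on an open `Q`, every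
weak spatial gradient `G`, every backward cylinder `Q_{r₀}(z) ⊆ Q` with `C(r₀; z) ≤ C₀`,
`D(r₀; z) ≤ D₀` and the absorption `C(r) ≤ ε (E(r) + A(r)) + f₁(ε)` (`ε > 0`, `0 < r ≤ r₀`):
`A + E + C + D ≤ K` on `Q_r(z)`, `0 < r < r₀/2`. Proof: verbatim the iteration of
`scaledEnergies_bounded_of_cubicAbsorption` ((as12) `Seregin2020.localEnergyBound_top`, (as13)
`seregin_sverak_pressure_decay_holds`, `SereginSverak2009.decay_step_half` / `iterate_halving`),
the top scales being controlled by `A(r₀/2) + E(r₀/2) ≤ K₀ (C₀^{2/3} + C₀ + D₀)` ((as12) at the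
base radius and monotonicity) and `D(r₀) ≤ D₀`.
[cite: SereginSverak2009, Lemma 3.5 and its proof (arXiv:0804.1803 pp. 9–10)]
[cite: Seregin2014, Ch. 6 §6.3 Prop. 3.11 (i)] -/
theorem scaledEnergies_bounded_of_cubicAbsorption_unif (f₁ : ℝ≥0 → ℝ≥0) (C₀ D₀ : ℝ≥0) :
    ∃ K : ℝ≥0, ∀ {Q : Opens (ℝ × EuclideanSpace ℝ (Fin 3))}
      {u : ℝ → EuclideanSpace ℝ (Fin 3) → EuclideanSpace ℝ (Fin 3)} {p : ℝ → EuclideanSpace ℝ (Fin 3) → ℝ}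
      {G : ℝ → EuclideanSpace ℝ (Fin 3) → EuclideanSpace ℝ (Fin 3) →L[ℝ] EuclideanSpace ℝ (Fin 3)},
      IsSuitableWeakSolutionOn Q 1 0 u p → HasWeakSpatialGradientOn Q u G →
      ∀ {z : ℝ × EuclideanSpace ℝ (Fin 3)} {r₀ : ℝ}, 0 < r₀ →
      parabolicCylinder r₀ z ⊆ (Q : Set (ℝ × EuclideanSpace ℝ (Fin 3))) →
      cknC r₀ z u ≤ C₀ → cknD r₀ z p ≤ D₀ →
      (∀ ε : ℝ≥0, 0 < ε → ∀ r ∈ Ioc (0 : ℝ) r₀,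
        cknC r z u ≤ ε * (cknE r z G + cknAEss r z u) + f₁ ε) →
      ∀ r ∈ Ioo (0 : ℝ) (r₀ / 2),
        cknAEss r z u + cknE r z G + cknC r z u + cknD r z p ≤ K := by
  -- ### the constants of (as12), (as13), and the parameters `ϑ`, `ε` (depending on them only)
  obtain ⟨c₁, c₂, c₃, HT⟩ := Seregin2020.localEnergyBound_top
  obtain ⟨c, hc⟩ := seregin_sverak_pressure_decay_holds.ratio
  set K : ℝ≥0 := max (c₁ + c₂ + c₃) c with hK
  have hK1 : c₁ ≤ K := (le_self_add.trans le_self_add).trans (le_max_left _ _)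
  have hK2 : c₂ + c₃ ≤ K :=
    ((le_add_self).trans_eq (add_assoc c₁ c₂ c₃).symm).trans (le_max_left _ _)
  have hK3 : c₃ ≤ K := (le_add_self).trans (le_max_left _ _)
  have hKc : (c : ℝ≥0∞) ≤ K := ENNReal.coe_le_coe.2 (le_max_right _ _)
  obtain ⟨ϑ, hϑ0, hϑ4, hKϑ⟩ := SereginSverak2009.exists_ratio (2 * K ^ 2 + K)
  obtain ⟨ε, hε0, hKε⟩ := SereginSverak2009.exists_parameter ((6 * K + K ^ 2) * (2 * ϑ)⁻¹ ^ 2)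
  have hϑR : (0 : ℝ) < ϑ := by exact_mod_cast hϑ0
  have hϑR4 : 4 * (ϑ : ℝ) ≤ 1 := by exact_mod_cast hϑ4
  have hϑ1R : (ϑ : ℝ) < 1 := by linarith
  -- `F = f₁(ε)`, the uniform top-scale bound `M`, the iteration constant `B`
  set F : ℝ≥0 := f₁ ε with hFdef
  set M : ℝ≥0∞ := ENNReal.ofReal ((ϑ : ℝ)⁻¹) *
      ((K : ℝ≥0∞) * ((C₀ : ℝ≥0∞) ^ (2 / 3 : ℝ) + C₀ + D₀)) +
    ENNReal.ofReal (2 * (ϑ : ℝ)⁻¹) ^ 2 * D₀ with hM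
  have hMtop : M ≠ ∞ := by
    refine ENNReal.add_ne_top.2 ⟨ENNReal.mul_ne_top ENNReal.ofReal_ne_top ?_,
      ENNReal.mul_ne_top (ENNReal.pow_ne_top ENNReal.ofReal_ne_top) ENNReal.coe_ne_top⟩
    exact ENNReal.mul_ne_top ENNReal.coe_ne_top (ENNReal.add_ne_top.2 ⟨ENNReal.add_ne_top.2
      ⟨ENNReal.rpow_ne_top_of_nonneg (by norm_num) ENNReal.coe_ne_top, ENNReal.coe_ne_top⟩,
      ENNReal.coe_ne_top⟩)
  set B : ℝ≥0 := (6 * K + K ^ 2) * (2 * ϑ)⁻¹ ^ 2 * F + K * (2 * ϑ)⁻¹ ^ 2 with hB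
  have hT : M + 2 * B + (ε * (M + 2 * B) + F) ≠ ∞ := by
    have hMB : M + 2 * B ≠ ∞ := ENNReal.add_ne_top.2 ⟨hMtop, by finiteness⟩
    exact ENNReal.add_ne_top.2 ⟨hMB, ENNReal.add_ne_top.2 ⟨ENNReal.mul_ne_top (by finiteness) hMB,
      by finiteness⟩⟩
  refine ⟨(M + 2 * B + (ε * (M + 2 * B) + F)).toNNReal, ?_⟩
  intro Q u p G hsw hG z r₀ hr₀ hQ hC₀ hD₀ habs r hr
  rw [ENNReal.coe_toNNReal hT]
  have hF : ∀ r ∈ Ioc (0 : ℝ) r₀, cknC r z u ≤ ε * (cknE r z G + cknAEss r z u) + F := habs ε hε0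
  -- ### reparametrisation `r = d s`, `d = 2 r₀`, `s ∈ ]0, 1/4[ ↔ r ∈ ]0, r₀/2[`
  set d : ℝ := 2 * r₀ with hd
  have hd0 : 0 < d := by positivity
  have hds : ∀ s ∈ Ioo (0 : ℝ) (1 / 4), 0 < d * s ∧ d * s < r₀ / 2 := fun s hs =>
    ⟨mul_pos hd0 hs.1, by rw [hd]; nlinarith [hs.2]⟩
  have hsubQ : ∀ s ∈ Ioo (0 : ℝ) (1 / 4),
      parabolicCylinder (d * s) z ⊆ (Q : Set (ℝ × EuclideanSpace ℝ (Fin 3))) := fun s hs =>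
    (parabolicCylinder_mono (hds s hs).1.le (by linarith [(hds s hs).2]) z).trans hQ
  -- (as11) on the reparametrised radii
  have h11 : ∀ s ∈ Ioo (0 : ℝ) (1 / 4),
      cknC (d * s) z u ≤ ε * (cknE (d * s) z G + cknAEss (d * s) z u) + F := fun s hs =>
    hF (d * s) ⟨(hds s hs).1, by linarith [(hds s hs).2]⟩
  -- (as12) on the reparametrised radii, from the local energy bound at the top
  have h12 : ∀ s ∈ Ioo (0 : ℝ) (1 / 4),
      cknE (d * (s / 2)) z G + cknAEss (d * (s / 2)) z u ≤
        K * (cknC (d * s) z u ^ (2 / 3 : ℝ) + cknC (d * s) z u + cknD (d * s) z p) := by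
    intro s hs
    have h := HT Q u p G hsw hG z (d * s) (hds s hs).1 (hsubQ s hs)
    rw [← mul_div_assoc, add_comm]
    exact h.trans (cubicAbsorptionBound_localEnergy_rhs_le hK1 hK2 hK3 _ _)
  -- (as13) on the reparametrised radii, from the pressure decay estimate
  have h13 : ∀ s ∈ Ioo (0 : ℝ) (1 / 4), ∀ κ : ℝ≥0, 0 < κ → κ ≤ 1 →
      cknD (d * ((κ : ℝ) * s)) z p ≤
        K * (κ * cknD (d * s) z p + ((κ⁻¹ ^ 2 : ℝ≥0) : ℝ≥0∞) * cknC (d * s) z u) := by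
    intro s hs κ hκ hκ1
    have hκR : (0 : ℝ) < κ := by exact_mod_cast hκ
    have hκ1R : (κ : ℝ) ≤ 1 := by exact_mod_cast hκ1
    have h := hc Q u p hsw.distributional z (d * s) κ (hds s hs).1 hκR hκ1R (hsubQ s hs)
    rw [ENNReal.ofReal_coe_nnreal, cubicAbsorptionBound_ofReal_inv_sq'] at h
    rw [show d * ((κ : ℝ) * s) = (κ : ℝ) * (d * s) by ring]
    exact h.trans (by gcongr)
  -- the scaling of `C`
  have hC : ∀ s ∈ Ioo (0 : ℝ) (1 / 4), ∀ κ : ℝ≥0, 0 < κ → κ ≤ 1 →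
      cknC (d * ((κ : ℝ) * s)) z u ≤ ((κ⁻¹ ^ 2 : ℝ≥0) : ℝ≥0∞) * cknC (d * s) z u := by
    intro s hs κ hκ hκ1
    have hκR : (0 : ℝ) < κ := by exact_mod_cast hκ
    have hκ1R : (κ : ℝ) ≤ 1 := by exact_mod_cast hκ1
    have hR := (hds s hs).1
    have hR' : 0 < (κ : ℝ) * (d * s) := mul_pos hκR hR
    have hsub : parabolicCylinder ((κ : ℝ) * (d * s)) z ⊆ parabolicCylinder (d * s) z :=
      parabolicCylinder_mono hR'.le (mul_le_of_le_one_left hR.le hκ1R) z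
    have h := Seregin2020.cknC_le_mul_of_subset hR hR' hsub u
    rw [div_mul_cancel_right₀ hR.ne' (κ : ℝ), cubicAbsorptionBound_ofReal_inv_sq] at h
    rwa [show d * ((κ : ℝ) * s) = (κ : ℝ) * (d * s) by ring]
  -- ### the top scales: `ℰ ≤ M` for `s ∈ [ϑ/4, 1/4[`, i.e. `r ∈ [ϑ r₀/2, r₀/2[`
  have hAEtop : cknAEss (r₀ / 2) z u + cknE (r₀ / 2) z G ≤
      (K : ℝ≥0∞) * ((C₀ : ℝ≥0∞) ^ (2 / 3 : ℝ) + C₀ + D₀) := by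
    have h := HT Q u p G hsw hG z r₀ hr₀ hQ
    calc cknAEss (r₀ / 2) z u + cknE (r₀ / 2) z G
        ≤ c₁ * cknC r₀ z u ^ (2 / 3 : ℝ) + c₂ * cknC r₀ z u +
            c₃ * (cknD r₀ z p ^ (2 / 3 : ℝ) * cknC r₀ z u ^ (1 / 3 : ℝ)) := h
      _ ≤ K * (cknC r₀ z u ^ (2 / 3 : ℝ) + cknC r₀ z u + cknD r₀ z p) :=
          cubicAbsorptionBound_localEnergy_rhs_le hK1 hK2 hK3 _ _
      _ ≤ K * ((C₀ : ℝ≥0∞) ^ (2 / 3 : ℝ) + C₀ + D₀) := by gcongr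
  have htop : ∀ s, (ϑ : ℝ) * (1 / 4) ≤ s → s < 1 / 4 →
      cknE (d * s) z G + cknAEss (d * s) z u + cknD (d * s) z p ≤ M := by
    intro s h1 h2
    have hs0 : 0 < s := lt_of_lt_of_le (by positivity) h1
    obtain ⟨hR, hRhalf⟩ := hds s ⟨hs0, h2⟩
    have hRr₀ : d * s ≤ r₀ := by linarith
    have hlow : r₀ * ϑ / 2 ≤ d * s := by rw [hd]; nlinarith
    have hratio1 : (r₀ / 2) / (d * s) ≤ (ϑ : ℝ)⁻¹ := by
      rw [div_le_iff₀ hR]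
      calc r₀ / 2 = (ϑ : ℝ)⁻¹ * (r₀ * ϑ / 2) := by field_simp
        _ ≤ (ϑ : ℝ)⁻¹ * (d * s) := by gcongr
    have hratio2 : r₀ / (d * s) ≤ 2 * (ϑ : ℝ)⁻¹ := by
      rw [div_le_iff₀ hR]
      calc r₀ = 2 * (ϑ : ℝ)⁻¹ * (r₀ * ϑ / 2) := by field_simp
        _ ≤ 2 * (ϑ : ℝ)⁻¹ * (d * s) := by gcongr
    have hsubH : parabolicCylinder (d * s) z ⊆ parabolicCylinder (r₀ / 2) z :=
      parabolicCylinder_mono hR.le hRhalf.le z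
    have hsub0 : parabolicCylinder (d * s) z ⊆ parabolicCylinder r₀ z :=
      parabolicCylinder_mono hR.le hRr₀ z
    have hE : cknE (d * s) z G ≤ ENNReal.ofReal ((ϑ : ℝ)⁻¹) * cknE (r₀ / 2) z G :=
      (cknE_le_mul_of_subset (half_pos hr₀) hR hsubH G).trans (by gcongr)
    have hA : cknAEss (d * s) z u ≤ ENNReal.ofReal ((ϑ : ℝ)⁻¹) * cknAEss (r₀ / 2) z u := by
      have hsq : (d * s) ^ 2 ≤ (r₀ / 2) ^ 2 := pow_le_pow_left₀ hR.le hRhalf.le 2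
      have hI : Ioo (z.1 - (d * s) ^ 2) z.1 ⊆ Ioo (z.1 - (r₀ / 2) ^ 2) z.1 :=
        Ioo_subset_Ioo (by linarith) le_rfl
      have hB : ball z.2 (d * s) ⊆ ball z.2 (r₀ / 2) := ball_subset_ball hRhalf.le
      exact (cknAEss_le_mul_of_subset (half_pos hr₀) hR hI hB u).trans (by gcongr)
    have hD : cknD (d * s) z p ≤ ENNReal.ofReal (2 * (ϑ : ℝ)⁻¹) ^ 2 * D₀ :=
      (cknD_le_mul_of_subset hr₀ hR hsub0 p).trans (by gcongr)
    calc cknE (d * s) z G + cknAEss (d * s) z u + cknD (d * s) z p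
        ≤ ENNReal.ofReal ((ϑ : ℝ)⁻¹) * cknE (r₀ / 2) z G +
          ENNReal.ofReal ((ϑ : ℝ)⁻¹) * cknAEss (r₀ / 2) z u +
          ENNReal.ofReal (2 * (ϑ : ℝ)⁻¹) ^ 2 * D₀ := add_le_add (add_le_add hE hA) hD
      _ = ENNReal.ofReal ((ϑ : ℝ)⁻¹) * (cknAEss (r₀ / 2) z u + cknE (r₀ / 2) z G) +
          ENNReal.ofReal (2 * (ϑ : ℝ)⁻¹) ^ 2 * D₀ := by ring
      _ ≤ M := by rw [hM]; gcongr
  -- ### the iteration: `ℰ ≤ M + 2B` on `]0, r₀/2[`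
  have hΦ : ∀ r ∈ Ioo (0 : ℝ) (r₀ / 2),
      cknE r z G + cknAEss r z u + cknD r z p ≤ M + 2 * B := by
    intro r hr
    have hs : r / d ∈ Ioo (0 : ℝ) (1 / 4) :=
      ⟨div_pos hr.1 hd0, by rw [div_lt_iff₀ hd0, hd]; linarith [hr.2]⟩
    have key := SereginSverak2009.iterate_halving
      (Φ := fun s => cknE (d * s) z G + cknAEss (d * s) z u + cknD (d * s) z p)
      (B := (B : ℝ≥0∞)) (M := M) (R := 1 / 4) hϑR hϑ1R (by positivity : (0 : ℝ) < ϑ * (1 / 4))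
      le_rfl ?_ htop hs.1 hs.2
    · have e : d * (r / d) = r := by field_simp
      simpa only [e] using key
    · -- the contraction `ℰ(ϑ s) ≤ ½ ℰ(s) + B`
      intro s hs0 hsR
      exact SereginSverak2009.decay_step_half (E := fun s => cknE (d * s) z G)
        (A := fun s => cknAEss (d * s) z u) (C := fun s => cknC (d * s) z u)
        (D := fun s => cknD (d * s) z p) hϑ0 hϑ4 hKϑ hKε h11 h12 h13 hC ⟨hs0, hsR⟩
  -- ### conclusion: `A + E + C + D ≤ (M + 2B) + (ε (M + 2B) + F)`
  have h1 := hΦ r hr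
  have h2 := hF r ⟨hr.1, by linarith [hr.2]⟩
  calc cknAEss r z u + cknE r z G + cknC r z u + cknD r z p
      = (cknE r z G + cknAEss r z u + cknD r z p) + cknC r z u := by ring
    _ ≤ (M + 2 * B) + (ε * (cknE r z G + cknAEss r z u) + F) := add_le_add h1 h2
    _ ≤ (M + 2 * B) + (ε * (M + 2 * B) + F) := by
        have hEA : cknE r z G + cknAEss r z u ≤ M + 2 * B := le_self_add.trans h1
        gcongr (M + 2 * (B : ℝ≥0∞)) + ((ε : ℝ≥0∞) * ?_ + (F : ℝ≥0∞))

/-- **Seregin 2014, Prop. 3.11 (i), case `G₂`, with the printed dependence of the constant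
(Seregin–Šverák 2009, Lemma 3.5: "`C₁` depending only on `C`, `‖v‖_{L³(Q)}`,
`‖q‖_{L^{3/2}(Q)}`").** For every Type-I constant `c` and bounds `C₀, D₀` there is `K` such that:
for every suitable weak solution `(u, p)` of the unforced unit-viscosity Navier–Stokes equations
on an open `Q ⊆ ℝ × ℝ³`, every weak spatial gradient `G` of `u` on `Q`, every backward cylinder
`Q_{r₀}(z) ⊆ Q` with `C(r₀; z) ≤ C₀`, `D(r₀; z) ≤ D₀` on which `√(t_z − t) ‖u(t, x)‖ ≤ c` a.e.,
the sum `A + E + C + D` (`cknAEss`, `cknE`, `cknC`, `cknD`) is at most `K` on every `Q_r(z)`,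
`0 < r < r₀/2` — the same `K` for all solutions, vertices and base radii.
[cite: Seregin2014, Ch. 6 §6.3 Prop. 3.11 (i)]
[cite: SereginSverak2009, Lemma 3.5 and its proof (arXiv pp. 9–10)] -/
theorem scaledEnergies_bounded_of_typeIRate_unif (c : ℝ) (C₀ D₀ : ℝ≥0) :
    ∃ K : ℝ≥0, ∀ {Q : Opens (ℝ × EuclideanSpace ℝ (Fin 3))}
      {u : ℝ → EuclideanSpace ℝ (Fin 3) → EuclideanSpace ℝ (Fin 3)} {p : ℝ → EuclideanSpace ℝ (Fin 3) → ℝ}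
      {G : ℝ → EuclideanSpace ℝ (Fin 3) → EuclideanSpace ℝ (Fin 3) →L[ℝ] EuclideanSpace ℝ (Fin 3)},
      IsSuitableWeakSolutionOn Q 1 0 u p → HasWeakSpatialGradientOn Q u G →
      ∀ {z : ℝ × EuclideanSpace ℝ (Fin 3)} {r₀ : ℝ}, 0 < r₀ →
      parabolicCylinder r₀ z ⊆ (Q : Set (ℝ × EuclideanSpace ℝ (Fin 3))) →
      cknC r₀ z u ≤ C₀ → cknD r₀ z p ≤ D₀ →
      (∀ᵐ w ∂(volume.restrict (parabolicCylinder r₀ z)), Real.sqrt (z.1 - w.1) * ‖u w.1 w.2‖ ≤ c) →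
      ∀ r ∈ Ioo (0 : ℝ) (r₀ / 2),
        cknAEss r z u + cknE r z G + cknC r z u + cknD r z p ≤ K := by
  obtain ⟨f₁, hf₁⟩ := cubicAbsorption_of_typeIRate_unif c
  obtain ⟨K, hK⟩ := scaledEnergies_bounded_of_cubicAbsorption_unif f₁ C₀ D₀
  refine ⟨K, ?_⟩
  intro Q u p G hsw hG z r₀ hr₀ hQ hC₀ hD₀ hI r hr
  have hu : AEStronglyMeasurable (uncurry u) (volume.restrict (parabolicCylinder r₀ z)) :=
    hsw.distributional.1.aestronglyMeasurable.mono_measure (Measure.restrict_mono hQ le_rfl)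
  exact hK hsw hG hr₀ hQ hC₀ hD₀ (fun ε hε => hf₁ hu hI G ε hε) r hr

end Literature.Analysis.FluidPDE

end
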